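import Mathlib
import HarnessLib
import Summits.ResolutionOfSingularities.ResolutionOfSingularities.Theorems.WildQuotientsWildQuotientResolutionJordanFiveBricksOneShot
import Summits.ResolutionOfSingularities.ResolutionOfSingularities.Theorems.WildQuotientsWildQuotientResolutionJordanFiveI12Stable
import Summits.ResolutionOfSingularities.ResolutionOfSingularities.Theorems.WildQuotientsWildQuotientResolutionJordanFiveChartD
import Summits.ResolutionOfSingularities.ResolutionOfSingularities.Theorems.WildQuotientsWildQuotientResolutionJordanFiveI12Divisorial
import Summits.ResolutionOfSingularities.ResolutionOfSingularities.Theorems.WildQuotientsWildQuotientResolutionJordanFiveChartW1Side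
import Summits.ResolutionOfSingularities.ResolutionOfSingularities.Theorems.WildQuotientsWildQuotientResolutionJordanFiveChartW2Side
import Summits.ResolutionOfSingularities.ResolutionOfSingularities.Theorems.WildQuotientsWildQuotientResolutionJordanFiveLociW1
import Summits.ResolutionOfSingularities.ResolutionOfSingularities.Theorems.WildQuotientsWildQuotientResolutionJordanFiveLociW2
import Summits.ResolutionOfSingularities.ResolutionOfSingularities.Theorems.WildQuotientsWildQuotientResolutionJordanFiveCover
import Summits.ResolutionOfSingularities.ResolutionOfSingularities.Theorems.WildQuotientsWildQuotientResolutionJordanFiveRingBrickZeroOneShot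
import Summits.ResolutionOfSingularities.ResolutionOfSingularities.Theorems.WildQuotientsWildQuotientResolutionJordanFiveRingBrickOne
import Summits.ResolutionOfSingularities.ResolutionOfSingularities.Theorems.WildQuotientsWildQuotientResolutionJordanFiveRingBrickTwo
import Summits.ResolutionOfSingularities.ResolutionOfSingularities.Theorems.WildQuotientsWildQuotientResolutionJordanFiveBrickH1OfRingSide
import Summits.ResolutionOfSingularities.ResolutionOfSingularities.Theorems.WildQuotientsWildQuotientResolutionJordanFiveChartW1Ring
import Summits.ResolutionOfSingularities.ResolutionOfSingularities.Theorems.WildQuotientsWildQuotientResolutionJordanFiveBrickHP0OneShot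
import Summits.ResolutionOfSingularities.ResolutionOfSingularities.Theorems.WildQuotientsWildQuotientResolutionJordanFiveRingBrickHP2ChartW2
import Summits.ResolutionOfSingularities.ResolutionOfSingularities.Theorems.WildQuotientsWildQuotientResolutionJordanFiveBrickH2OfRingSide

/-!
# RUNG V5 FINAL: `JordanFive.jordanFive_hasResolution` — every `𝔸ⁿ/J₅` (`p ≥ 5`) has a resolution

(crux stmt-ResolutionOfSingularities-15640 `WildQuotients.WildQuotientResolution`, line `Sketch`;
chain w45c RUNG V5, REGISTERED STUB `JordanFive.jordanFive_hasResolution` of the crux item (signature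
verbatim below). [OURS · L1 W4.5c] — NOT a statement of any manuscript (Hironaka 2017 is consumed
nowhere); it does not close the crux (`J₅` is the linear Jordan-block sector, `n ≥ 5`), it is the
fifth rung of the wild-quotient ladder. Lead prover res-L1-w45c-lead-1; bricks by res-L1-w45c-stub-1…5,
res-type-036, res-D-pv-033 (credits per brick below). AI-written Lean, kernel-checked; weaker than
expert review.)

THE PROOF (plan of record β‴, `L/w45c/CHAIN.md` v8.7, `HP0-ONESHOT-DESIGN.md`): blow up the
`(4,3,2,1)`-weighted centre `I₁₂ = ⟨40 monomials⟩` of `𝔸ⁿ` (`⟨σ⟩`-stable, `idealSheaf_I12_comap`),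
descend to `Y = V/⟨σ⟩`, and resolve `Y` by the one-shot toric exit `jordanFive_hasResolution_of_bricks'`
(p536385): four stable pieces — `O₃ = chart 3` (K–L terminal: `isRegularLocalRing_stalk_of_mem_chart_three`,
`isPrincipal_stalkAug_liftAction_of_mem_chart_three`, res-L1-w45c-stub-3), `O₁ = chartW₁` (μ₃ cone,
`HP₁ := coneBrick_one_of_ringBrick … (brickH₁_of_ringSide … (exists_ringBrick_X1_chartW₁ …))`,
res-L1-w45c-stub-1/stub-2/stub-5), `O₂ = chartW₂` (μ₂-HIGH, `HP₂ := coneBrick_two_of_ringBrick …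
(brickH₂_of_ringSide … (exists_ringBrick_HP2_chartW₂ …))`, res-type-036/res-D-pv-033/stub-3 with this
seat's range conversion `chartW₂_coverFixed_iff`), `O₀ = chart 0` (μ₄ vertex, ONE blow-up along
`𝓘·(𝓘²:𝓘_A)`, `HP₀ := coneBrick_zero_of_ringBrick' … (brickHP0' …)`, res-L1-w45c-stub-4/stub-2 with
this seat's `exists_ringEquiv_blowupChart0_weightZero`), glued by `chart_zero_sup_chartW₁_sup_chartW₂_sup_chart_three_eq_top`
and the loci disjointness lemmas (stub-5).
-/

set_option linter.dupNamespace false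

noncomputable section

open CategoryTheory AlgebraicGeometry TopologicalSpace MvPolynomial
open Literature.AlgebraicGeometry.Resolution Literature.AlgebraicGeometry.RelativeSpec
open scoped Pointwise

namespace Summit.ResolutionOfSingularities.ResolutionOfSingularities.Theorems.WildQuotientResolution.JordanFive

set_option maxHeartbeats 4000000 in
/-- **RUNG V5**: for every prime `p ≥ 5`, every field `k` of characteristic `p`, every `n` and
every `J₅` datum `σ` on `k[x₁,…,xₙ]` (a single Jordan block of size five plus passengers),
`Spec k[x]^⟨σ⟩` has a resolution of singularities. [OURS · L1 W4.5c] -/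
theorem jordanFive_hasResolution (p : ℕ) (hp : p.Prime) (hp5 : 5 ≤ p) (k : Type) [Field k]
    [CharP k p] (n : ℕ) (σ : MvPolynomial (Fin n) k ≃ₐ[k] MvPolynomial (Fin n) k)
    (a b c d e : Fin n) (hab : a ≠ b) (hac : a ≠ c) (had : a ≠ d) (hae : a ≠ e) (hbc : b ≠ c)
    (hbd : b ≠ d) (hbe : b ≠ e) (hcd : c ≠ d) (hce : c ≠ e) (hde : d ≠ e)
    (hb : σ (X b) = X b + X a) (hc : σ (X c) = X c + X b) (hd : σ (X d) = X d + X c)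
    (he : σ (X e) = X e + X d) (hσ : ∀ i, i ≠ b → i ≠ c → i ≠ d → i ≠ e → σ (X i) = X i) :
    Scheme.HasResolution
      (Spec (.of (FixedPoints.subalgebra k (MvPolynomial (Fin n) k) (Subgroup.zpowers σ)))) := by
  haveI : Fact p.Prime := ⟨hp⟩
  have ha : σ (X a) = X a := hσ a hab hac had hae
  haveI : Finite ↥(Subgroup.zpowers σ) :=
    finite_zpowers k n σ a b c d e hab hac had hae hb hc hd he hσ p hp hp5
  have h2 : (2 : k) ≠ 0 := by
    intro h
    have h' : p ∣ 2 := (CharP.cast_eq_zero_iff k p 2).mp (by exact_mod_cast h)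
    have := Nat.le_of_dvd two_pos h'
    omega
  have hI : ∀ g : ↥(Subgroup.zpowers σ), g • I12 k n a b c d = I12 k n a b c d :=
    smul_I12_eq k n a b c d hab hac had hbc hbd hcd σ ha hb hc hd
  exact jordanFive_hasResolution_of_bricks' p hp hp5 k n σ a b c d e hab hac had hae hbc hbd hbe
    hcd hce hde hb hc hd he hσ
    (fun ρ hρ => idealSheaf_I12_comap k n a b c d hab hac had hbc hbd hcd σ ha hb hc hd ρ hρ)
    (isRegularLocalRing_stalk_of_mem_chart_three k n a b c d hab hac had hbc hbd hcd)
    (fun ρ hρ g v hv hv3 => isPrincipal_stalkAug_liftAction_of_mem_chart_three p hp hp5 k n σ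
      a b c d e hab hac had hae hb hc hd he hσ ρ hρ _ g v hv hv3)
    (chartW₁ k n a b c d) (chartW₂ k n a b c d e)
    (fun ρ hρ g => preimage_chartW₁_eq k n σ a b c d e hab hac had hae hb hc hd hσ hI ρ hρ _ g)
    (isAffineOpen_chartW₁ k n a b c d)
    (fun ρ hρ g => preimage_chartW₂_eq k n σ a b c d e hab hac had hae hb hc hd he hσ hI ρ hρ _ g)
    (isAffineOpen_chartW₂ k n a b c d e)
    (chart_zero_sup_chartW₁_sup_chartW₂_sup_chart_three_eq_top k n a b c d e h2)
    (disjoint_edgeSurface_chartW₁ k n a b c d) (disjoint_vertexCurve_zero_chartW₁ k n a b c d)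
    (disjoint_vertexCurve_one_chartW₂ k n a b c d e) (disjoint_vertexCurve_zero_chartW₂ k n a b c d e)
    -- HP₁ := μ₃ cone brick at W₁ = chartW₁ from the ring brick H₁ (stub-1/stub-2/stub-5 `brickH₁`)
    (coneBrick_one_of_ringBrick p hp hp5 k n σ a b c d e hab hac had hae hbc hbd hcd hb hc hd hσ
      (brickH₁_of_ringSide p hp hp5 k n σ a b c d e hab hac had hae hbc hbd hcd hb hc hd hσ
        (exists_ringBrick_X1_chartW₁ k n a b c d e p hp hp5 σ hab hac had hae hbc hbd hbe hcd hce
          hde hb hc hd he hσ)))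
    -- HP₂ := μ₂-HIGH brick at W₂ = chartW₂ from the ring brick H₂ (036/stub-5 `brickH₂`)
    (coneBrick_two_of_ringBrick p hp hp5 k n σ a b c d e hab hac had hae hbc hbd hcd hb hc hd hσ
      (brickH₂_of_ringSide p hp hp5 k n σ a b c d e hab hac had hae hbc hbd hcd hb hc hd he hσ
        (exists_ringBrick_HP2_chartW₂ p hp hp5 k n σ a b c d e hab hac had hae hbc hbd hbe hcd hce
          hde hb hc hd he hσ)))
    -- HP₀ := one-shot μ₄ brick from the ring brick H₀′ (stub-4 `brickHP0'`)
    (coneBrick_zero_of_ringBrick' p hp hp5 k n σ a b c d e hab hac had hae hbc hbd hcd hb hc hd hσ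
      (brickHP0' p hp hp5 k n σ a b c d e hab hac had hae hbc hbd hbe hcd hce hde hb hc hd he hσ))

end Summit.ResolutionOfSingularities.ResolutionOfSingularities.Theorems.WildQuotientResolution.JordanFive

end
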